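import Literature.AlgebraicGeometry.HodgeTheory.SmoothBlowupHodgeConjecture
import Literature.AlgebraicGeometry.ShiodaKatsura1979.InductiveStructureMap
import HarnessLib

/-!
# Shioda–Katsura's inductive structure for split hypersurfaces `f(x) + g(y) = 0`: the smooth blow-up
# of `F_f × F_g` along `B_f × B_g` maps onto `X_{f,g}` (Thm. 1.7 / Remark 1.10), and the resulting
# transfer of the Hodge conjecture

Topic `Literature/AlgebraicGeometry/ShiodaKatsura1979` (next to `InductiveStructureMap`, which proves the
polynomial identities of Lemma 1.1 / Remark 1.10: the substitution (1.3) carries the equation of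
`X_{f,g}` into the ideal of `F_f × F_g`, with indeterminacy exactly `{x_∞ = y_∞ = 0} ≅ B_f × B_g`).
Written by the literature-typing seat `littype-FH1-2` (cell `hodge-nonav`) at the request of planner P3
(memo ROUTE-P3v20-g28 «SPLIT HYPERSURFACES», typing target I1; sketch
`HOME/p3/split-g28/SplitSketch.lean`): the ONE printed geometric input of the chapter, in the tree's
scheme vocabulary (`SchemeOver ℂ`, `IsSmoothProjective`, `IsHypersurfaceCutOutBy`, the cartesian product
`⊗`, the smooth blow-up datum `IsSmoothBlowupAlong` of `HodgeClassesBlowupBirationalInvariance`), plus the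
PROVED Hodge-conjecture transfer the planner consumes (`SplitTransferHC` of the sketch).

## Source, verbatim (T. Shioda, T. Katsura, *On Fermat varieties*, Tôhoku Math. J. 31 (1979) 97–115
## [ShiodaKatsura1979]; held text `paper:url-2b12de8f7b5b`, pages p0002–p0006; the scan drops the
## displayed formulas, which are transcribed as in `InductiveStructureMap`)

* p0002, §1: "Let `m, r` and `s` be positive integers […] **Lemma 1.1.** There exists a rational map of
  degree `m` (1.2) `φ : Xʳₘ × Xˢₘ → X^{r+s}ₘ` defined by (1.3) `zᵢ = xᵢ y_{s+1}` (`i = 0, 1, …, r`),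
  `z_{r+1+j} = ε x_{r+1} y_j` (`j = 0, 1, …, s`), `ε` being a fixed `2m`-th root of unity such that
  `εᵐ = −1`. […] Let `Y` denote the locus of points of `Xʳₘ × Xˢₘ` where the rational map `φ` is not
  defined. Then `Y` is the subvariety of `Xʳₘ × Xˢₘ` defined by `x_{r+1} = y_{s+1} = 0`, which can be
  naturally identified with `X^{r−1}ₘ × X^{s−1}ₘ`. Let (1.4) `β : Z → Xʳₘ × Xˢₘ` denote the blowing up
  of `Xʳₘ × Xˢₘ` along the non-singular center `Y`."
* p0003: "**Lemma 1.2.** The composed map (1.9) `ψ = φ ∘ β : Z → X^{r+s}ₘ` is a morphism."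
* p0005–p0006: "**Theorem 1.7.** There exists a commutative diagram (1.25) where 1) `β` is the blowing up
  of `Xʳₘ × Xˢₘ` along the center `Y`, 2) `π` is the quotient morphism, and 3) `ψ̄` is a birational
  morphism blowing down the two subvarieties from the quotient to the disjoint subvarieties […] of
  `X^{r+s}ₘ`."  "**Remark 1.8.** […] Theorem 1.7 can be proven in the category of schemes, smooth and
  projective over `ℤ[1/m, e^{2πi/m}]`, without any essential alteration."
* p0006: "**Remark 1.10.** The proof given above for Theorem 1.7 can be applied to a slightly more general
  situation. Namely, let `Xʳₘ` (or `Xˢₘ`) denote for a moment arbitrary non-singular hypersurface of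
  degree `m` defined by `f(x₀, …, x_r) + x_{r+1}ᵐ = 0` (or `g(y₀, …, y_s) + y_{s+1}ᵐ = 0`) and let
  `X^{r−1}ₘ, X^{s−1}ₘ` and `X^{r+s}ₘ` respectively denote the hypersurfaces: (1.1)′
  `f(x₀, …, x_r) = 0`, `g(y₀, …, y_s) = 0`, `f(x₀, …, x_r) + g(y₀, …, y_s) = 0`. Then `X^{r+s}ₘ` is
  obtained from the product `Xʳₘ × Xˢₘ` by exactly the same steps as those described in Theorem 1.7
  for the case of Fermat varieties."

## Rendering

For forms `f` (in `x₀..x_r`) and `g` (in `y₀..y_s`) of degree `m`: the FERMAT SUSPENSIONS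
`F_f = V(f + u^m) ⊂ ℙ^{r+1}`, `F_g = V(g + v^m) ⊂ ℙ^{s+1}` (`suspension`), the BASES `B_f = V(f) ⊂ ℙ^r`,
`B_g = V(g) ⊂ ℙ^s`, and the SPLIT HYPERSURFACE `X_{f,g} = V(f(x) + g(y)) ⊂ ℙ^{r+s+1}` (`splitForm`), all
given as abstract `SchemeOver ℂ` with `IsHypersurfaceCutOutBy` (as in the consumer sketch).  The named
fact `shiodaKatsura1979_split_smoothBlowup_surjective` records, of Theorem 1.7 / Lemma 1.2 / Remark 1.10,
exactly what the Hodge-conjecture transfer consumes and nothing finer: when `F_f, F_g, B_f, B_g, X_{f,g}`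
are smooth (the source's "non-singular"), there is a smooth blow-up `b : Z → F_f × F_g` along a closed
immersion `B_f × B_g ↪ F_f × F_g` (the centre `Y = {x_{r+1} = y_{s+1} = 0}`; datum `IsSmoothBlowupAlong`)
and a SURJECTIVE morphism `Z → X_{f,g}` (`ψ = φ ∘ β` of Lemma 1.2: dominant of degree `m`, indeed the
composite of the finite quotient `π` and the birational morphism `ψ̄` of Theorem 1.7, hence onto).
The finer printed content (the `μₘ`-quotient, the two blow-downs, the cohomological formula of
Prop. 2.4) is not vendored here.
`-- TODO(general form): r = 1 or s = 1 (the centre B_f × B_g then has a reducible factor = m points,`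
`-- not an IsSmoothProjective scheme); the quotient/blow-down half of Thm. 1.7 and Prop. 2.4.`

* §1 `inX`, `inY`, `splitForm r s f g = f(x) + g(y)`, `suspension m r f = f + u^m` (definitions with
  bodies, identical to the consumer sketch), homogeneity, and the bridge to the `Option`/`Sum`-indexed
  `coneForm`/`sumForm` of `InductiveStructureMap` (`suspension_eq_rename_coneForm`,
  `splitForm_eq_rename_sumForm`).
* §2 the named fact.  DISCHARGE ROAD (tree, theorem-only, not completed here): the smooth blow-up
  along a smooth centre EXISTS and is smooth projective (`HodgeTheory.exists_isSmoothBlowupAlong`, from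
  `Resolution.exists_isBlowup_ker_isSmoothProjective`); Shioda–Katsura's `ψ = (v x : u y)` IS A MORPHISM
  on any blow-up of `X₁ ⊗ X₂` along the product centre `pr₁⁻¹K₁ + pr₂⁻¹K₂` and is computed on points
  (`Motives/TensorBlowupJoinMap`: `locallyComparable_blowup`, `exists_comp_joinMap_eq_pointOfVec`;
  `Resolution/JoinRationalMap(Points)`: `RuledJoin.joinMap`) — written for the Fermat tower
  (`HodgeTheory/FermatBlowupHostsPackage`). What that development does not (yet) contain is exactly the
  remainder of this fact: the identification of the scheme-theoretic sections `F_f ∩ {u = 0}`,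
  `F_g ∩ {v = 0}` with `B_f`, `B_g`, that `ψ` (twisted by `ε`, `εᵐ = −1`, on the `y`-block) lands in
  `X_{f,g}`, and that it is onto.
* §3 PROVED consequences: **`hodgeConjectureFor_split_of_smoothBlowupHC`** — granted the fact and the
  tree's smooth blow-up transfer `Arapura2001_hodgeClasses_algebraic_smoothBlowup`
  (`HC(F_f × F_g) ∧ HC(B_f × B_g) ⇒ HC(Z)`), the Hodge conjecture for `F_f × F_g` and for `B_f × B_g`
  implies it for `X_{f,g}` (descent along the surjective `Z → X_{f,g}` of the same dimension,
  `HodgeConjectureFor.of_surjective`); **`hodgeConjectureFor_split_of_pullbackAlgebraic`** — the same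
  granted instead Fulton's pull-back fact `fulton1998_map_mem_algebraicClasses`, through the tree's
  reduction `Arapura2001_hodgeClasses_algebraic_smoothBlowup_of_pullbackAlgebraic` (the pull-back fact is
  a theorem on the Summits side, `…Theorems.fulton1998_map_mem_algebraicClasses_holds`). This is
  COROLLARY TS-HC(a) / `SplitTransferHC m r s` of the planner's memo, for `r, s ≥ 1`.

## References

* [ShiodaKatsura1979] T. Shioda, T. Katsura, On Fermat varieties, Tôhoku Math. J. 31 (1979) 97–115, §1
  Lemma 1.1, Lemma 1.2, Thm. 1.7, Remarks 1.8, 1.10. [cite: ShiodaKatsura1979, §1 Thm. 1.7 and Remark 1.10]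
* [Arapura2001HodgeCyclesModuli] D. Arapura, Motivation for Hodge cycles, Lemma 16 (smooth blow-ups).
* [vanGeemen1994HodgeAV] B. van Geemen, An introduction to the Hodge conjecture for abelian varieties,
  Lemma 3.7 (descent along surjections).
-/

noncomputable section

open CategoryTheory AlgebraicGeometry MonoidalCategory MvPolynomial
open Literature.AlgebraicGeometry.Motives Literature.AlgebraicGeometry.HodgeTheory

namespace Literature.AlgebraicGeometry.ShiodaKatsura1979

/-! ### §1 The forms `f(x) + g(y)` and `f + u^m` on `Fin`-indexed variables -/

section Forms

variable (m r s : ℕ)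

/-- The `x`-variables `x₀, …, x_r` sit at the indices `0, …, r` of the `r + s + 2` homogeneous
coordinates of `ℙ^{r+s+1}`. [cite: ShiodaKatsura1979, §1 Remark 1.10 (1.1)′] -/
def inX (i : Fin (r + 1)) : Fin (r + s + 2) := ⟨i.val, by omega⟩

/-- The `y`-variables `y₀, …, y_s` sit at the indices `r + 1, …, r + s + 1`.
[cite: ShiodaKatsura1979, §1 Remark 1.10 (1.1)′] -/
def inY (j : Fin (s + 1)) : Fin (r + s + 2) := ⟨r + 1 + j.val, by omega⟩

variable {r s} in
/-- `inX` and `inY` have disjoint images. [cite: ShiodaKatsura1979, §1 Remark 1.10 (1.1)′] -/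
theorem inX_ne_inY (i : Fin (r + 1)) (j : Fin (s + 1)) : inX r s i ≠ inY r s j := by
  intro h
  have := congrArg Fin.val h
  simp only [inX, inY] at this
  omega

/-- `inX` is injective. [cite: ShiodaKatsura1979, §1 Remark 1.10 (1.1)′] -/
theorem inX_injective : Function.Injective (inX r s) := fun i i' h => by
  have := congrArg Fin.val h; simp only [inX] at this; exact Fin.ext this

/-- `inY` is injective. [cite: ShiodaKatsura1979, §1 Remark 1.10 (1.1)′] -/
theorem inY_injective : Function.Injective (inY r s) := fun j j' h => by
  have := congrArg Fin.val h; simp only [inY] at this; exact Fin.ext (by omega)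

/-- **The split form** `f(x₀, …, x_r) + g(y₀, …, y_s)` in the `r + s + 2` variables of `ℙ^{r+s+1}`
(equation (1.1)′ of `X^{r+s}`). [cite: ShiodaKatsura1979, §1 Remark 1.10 (1.1)′] -/
def splitForm (f : MvPolynomial (Fin (r + 1)) ℂ) (g : MvPolynomial (Fin (s + 1)) ℂ) :
    MvPolynomial (Fin (r + s + 2)) ℂ :=
  rename (inX r s) f + rename (inY r s) g

/-- **The Fermat suspension** `f(x₀, …, x_r) + u^m` in `r + 2` variables, `u` the last one (equation of
Remark 1.10's `Xʳₘ : f + x_{r+1}^m = 0`). [cite: ShiodaKatsura1979, §1 Remark 1.10] -/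
def suspension (f : MvPolynomial (Fin (r + 1)) ℂ) : MvPolynomial (Fin (r + 2)) ℂ :=
  rename Fin.castSucc f + X (Fin.last (r + 1)) ^ m

variable {m r s}

/-- The split form of two forms of degree `m` is a form of degree `m`.
[cite: ShiodaKatsura1979, §1 Remark 1.10 (1.1)′] -/
theorem isHomogeneous_splitForm {f : MvPolynomial (Fin (r + 1)) ℂ} {g : MvPolynomial (Fin (s + 1)) ℂ}
    (hf : f.IsHomogeneous m) (hg : g.IsHomogeneous m) : (splitForm r s f g).IsHomogeneous m := by
  unfold splitForm
  exact hf.rename_isHomogeneous.add hg.rename_isHomogeneous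

/-- The suspension of a form of degree `m` is a form of degree `m`. [cite: ShiodaKatsura1979, §1 Remark 1.10] -/
theorem isHomogeneous_suspension {f : MvPolynomial (Fin (r + 1)) ℂ} (hf : f.IsHomogeneous m) :
    (suspension m r f).IsHomogeneous m := by
  unfold suspension
  exact hf.rename_isHomogeneous.add (isHomogeneous_X_pow _ _)

/-- Bridge to `InductiveStructureMap`: the suspension is the cone form `coneForm m f` with its
`Option (Fin (r+1))`-indexed variables renamed `some i ↦ i`, `none ↦ r + 1`.
[cite: ShiodaKatsura1979, §1 Remark 1.10] -/
theorem suspension_eq_rename_coneForm (f : MvPolynomial (Fin (r + 1)) ℂ) :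
    suspension m r f = rename (fun v : Option (Fin (r + 1)) => v.elim (Fin.last (r + 1)) Fin.castSucc)
      (coneForm m f) := by
  simp only [suspension, coneForm, map_add, map_pow, rename_X, rename_rename, Option.elim_none]
  rfl

/-- Bridge to `InductiveStructureMap`: the split form is the sum form `sumForm f g` with its
`Fin (r+1) ⊕ Fin (s+1)`-indexed variables renamed by `inX`/`inY`.
[cite: ShiodaKatsura1979, §1 Remark 1.10 (1.1)′] -/
theorem splitForm_eq_rename_sumForm (f : MvPolynomial (Fin (r + 1)) ℂ) (g : MvPolynomial (Fin (s + 1)) ℂ) :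
    splitForm r s f g = rename (Sum.elim (inX r s) (inY r s)) (sumForm f g) := by
  simp only [splitForm, sumForm, map_add, rename_rename]
  rfl

end Forms

/-! ### §2 The named fact: the smooth blow-up of `F_f × F_g` along `B_f × B_g` maps onto `X_{f,g}` -/

/-- **Named fact (Shioda–Katsura 1979, §1 Lemma 1.1–1.2, Theorem 1.7, Remarks 1.8 and 1.10 — the
inductive structure of the split hypersurface `f(x) + g(y) = 0`).** Let `m, r, s ≥ 1`, let `f` and `g`
be forms of degree `m` in `r + 1` resp. `s + 1` variables, and suppose the hypersurfaces
`B_f = V(f) ⊂ ℙ^r`, `B_g = V(g) ⊂ ℙ^s`, the Fermat suspensions `F_f = V(f + u^m) ⊂ ℙ^{r+1}`,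
`F_g = V(g + v^m) ⊂ ℙ^{s+1}` and the split hypersurface `X = V(f(x) + g(y)) ⊂ ℙ^{r+s+1}` are smooth
("non-singular", Remark 1.10). Then there are a smooth blow-up `b : Z → F_f × F_g` of the (smooth
projective, `(r+s)`-dimensional) product along a closed immersion of the (smooth projective,
`(r−1)+(s−1)`-dimensional) product `B_f × B_g` — the centre `Y = {x_{r+1} = y_{s+1} = 0}` "naturally
identified with `X^{r−1} × X^{s−1}`", (1.4) — and a SURJECTIVE morphism `Z → X` — the morphism
`ψ = φ ∘ β` of Lemma 1.2, which by Theorem 1.7 is the finite quotient `π` followed by the birational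
morphism `ψ̄`, hence onto. (Only this much of the printed diagram (1.25) is recorded; for `r = 1` or
`s = 1` the hypothesis `IsSmoothProjective 0 B` — an irreducible point — restricts to `m = 1`.)
Partial discharge road in the tree (theorem-only): `exists_isSmoothBlowupAlong` (the smooth blow-up),
`Motives/TensorBlowupJoinMap` + `Resolution/JoinRationalMap(Points)` (`ψ` is a morphism on the blow-up
along the product centre, and its values on points); missing: `F_• ∩ {last = 0} ≅ B_•`, `ψ(Z) = X`.
`-- TODO(general form): the μ_m-quotient and the two blow-downs of Thm. 1.7; Prop. 2.4 (cohomology).`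
[cite: ShiodaKatsura1979, §1 Lemma 1.2, Thm. 1.7, Remark 1.10 (held text p0002 L20–L31, p0003 L19–L21, p0005 L31 – p0006 L26)] -/
def shiodaKatsura1979_split_smoothBlowup_surjective : Prop :=
  ∀ (m r s : ℕ), 1 ≤ m → 1 ≤ r → 1 ≤ s →
  ∀ (f : MvPolynomial (Fin (r + 1)) ℂ) (g : MvPolynomial (Fin (s + 1)) ℂ),
    f.IsHomogeneous m → g.IsHomogeneous m →
  ∀ (B_f B_g F_f F_g X : SchemeOver ℂ),
    IsSmoothProjective (r - 1) B_f → IsHypersurfaceCutOutBy r f B_f →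
    IsSmoothProjective (s - 1) B_g → IsHypersurfaceCutOutBy s g B_g →
    IsSmoothProjective r F_f → IsHypersurfaceCutOutBy (r + 1) (suspension m r f) F_f →
    IsSmoothProjective s F_g → IsHypersurfaceCutOutBy (s + 1) (suspension m s g) F_g →
    IsSmoothProjective (r + s) X → IsHypersurfaceCutOutBy (r + s + 1) (splitForm r s f g) X →
    ∃ (Z : SchemeOver ℂ) (i : B_f ⊗ B_g ⟶ F_f ⊗ F_g) (b : Z ⟶ F_f ⊗ F_g) (ψ : Z ⟶ X),
      IsSmoothBlowupAlong (r + s) ((r - 1) + (s - 1)) (F_f ⊗ F_g) (B_f ⊗ B_g) Z i b ∧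
      Surjective ψ.left

/-! ### §3 Proved consequence: the Hodge conjecture passes from `F_f × F_g` and `B_f × B_g` to `X_{f,g}` -/

section Transfer

variable {m r s : ℕ}

/-- **The Hodge conjecture for `F_f × F_g` and for `B_f × B_g` implies the Hodge conjecture for the
split hypersurface `X_{f,g}`** — granted Shioda–Katsura's inductive structure and the smooth blow-up
transfer `HC(V) ∧ HC(W) ⇒ HC(Bl_W V)` (Arapura 2001 Lemma 16, the tree's named fact
`Arapura2001_hodgeClasses_algebraic_smoothBlowup`): `HC(Z)` for the blow-up `Z`, then descent along the
surjection `Z → X` between smooth projective varieties of the same dimension `r + s`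
(`HodgeConjectureFor.of_surjective`). This is COROLLARY TS-HC(a) / `SplitTransferHC m r s` of the
consumer memo. [cite: ShiodaKatsura1979, §1 Thm. 1.7 and Remark 1.10]
[cite: Arapura2001HodgeCyclesModuli, Lemma 16] [cite: vanGeemen1994HodgeAV, §3.7 Lemma 3.7] -/
theorem hodgeConjectureFor_split_of_smoothBlowupHC (hSK : shiodaKatsura1979_split_smoothBlowup_surjective)
    (hBl : Arapura2001_hodgeClasses_algebraic_smoothBlowup)
    (hm : 1 ≤ m) (hr : 1 ≤ r) (hs : 1 ≤ s)
    {f : MvPolynomial (Fin (r + 1)) ℂ} {g : MvPolynomial (Fin (s + 1)) ℂ}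
    (hf : f.IsHomogeneous m) (hg : g.IsHomogeneous m)
    {B_f B_g F_f F_g X : SchemeOver ℂ}
    (hBf : IsSmoothProjective (r - 1) B_f) (cBf : IsHypersurfaceCutOutBy r f B_f)
    (hBg : IsSmoothProjective (s - 1) B_g) (cBg : IsHypersurfaceCutOutBy s g B_g)
    (hFf : IsSmoothProjective r F_f) (cFf : IsHypersurfaceCutOutBy (r + 1) (suspension m r f) F_f)
    (hFg : IsSmoothProjective s F_g) (cFg : IsHypersurfaceCutOutBy (s + 1) (suspension m s g) F_g)
    (hX : IsSmoothProjective (r + s) X) (cX : IsHypersurfaceCutOutBy (r + s + 1) (splitForm r s f g) X)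
    (hFF : HodgeConjectureFor (r + s) (F_f ⊗ F_g))
    (hBB : HodgeConjectureFor ((r - 1) + (s - 1)) (B_f ⊗ B_g)) :
    HodgeConjectureFor (r + s) X := by
  obtain ⟨Z, i, b, ψ, hblow, hψ⟩ :=
    hSK m r s hm hr hs f g hf hg B_f B_g F_f F_g X hBf cBf hBg cBg hFf cFf hFg cFg hX cX
  have hZ : HodgeConjectureFor (r + s) Z := hBl i b hblow hFF hBB
  haveI : Surjective ψ.left := hψ
  exact hZ.of_surjective hblow.top hX ψ

/-- **The same transfer granted Fulton's pull-back fact** (`fulton1998_map_mem_algebraicClasses`,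
Fulton Cor. 19.2 (b) — a theorem on the Summits side of the tree), through the tree's reduction of the
smooth blow-up transfer to it (`Arapura2001_hodgeClasses_algebraic_smoothBlowup_of_pullbackAlgebraic`).
[cite: ShiodaKatsura1979, §1 Thm. 1.7 and Remark 1.10] [cite: Arapura2001HodgeCyclesModuli, Lemma 16]
[cite: Fulton1998, §19.2 Cor. 19.2 (b)] -/
theorem hodgeConjectureFor_split_of_pullbackAlgebraic (hSK : shiodaKatsura1979_split_smoothBlowup_surjective)
    (hF : fulton1998_map_mem_algebraicClasses)
    (hm : 1 ≤ m) (hr : 1 ≤ r) (hs : 1 ≤ s)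
    {f : MvPolynomial (Fin (r + 1)) ℂ} {g : MvPolynomial (Fin (s + 1)) ℂ}
    (hf : f.IsHomogeneous m) (hg : g.IsHomogeneous m)
    {B_f B_g F_f F_g X : SchemeOver ℂ}
    (hBf : IsSmoothProjective (r - 1) B_f) (cBf : IsHypersurfaceCutOutBy r f B_f)
    (hBg : IsSmoothProjective (s - 1) B_g) (cBg : IsHypersurfaceCutOutBy s g B_g)
    (hFf : IsSmoothProjective r F_f) (cFf : IsHypersurfaceCutOutBy (r + 1) (suspension m r f) F_f)
    (hFg : IsSmoothProjective s F_g) (cFg : IsHypersurfaceCutOutBy (s + 1) (suspension m s g) F_g)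
    (hX : IsSmoothProjective (r + s) X) (cX : IsHypersurfaceCutOutBy (r + s + 1) (splitForm r s f g) X)
    (hFF : HodgeConjectureFor (r + s) (F_f ⊗ F_g))
    (hBB : HodgeConjectureFor ((r - 1) + (s - 1)) (B_f ⊗ B_g)) :
    HodgeConjectureFor (r + s) X :=
  hodgeConjectureFor_split_of_smoothBlowupHC hSK
    (Arapura2001_hodgeClasses_algebraic_smoothBlowup_of_pullbackAlgebraic hF)
    hm hr hs hf hg hBf cBf hBg cBg hFf cFf hFg cFg hX cX hFF hBB

end Transfer

end Literature.AlgebraicGeometry.ShiodaKatsura1979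

end
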